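import Literature.NumberTheory.Automorphic.JacquetModuleExactProofs
import Literature.NumberTheory.Automorphic.ParabolicInductionQuotientProofs
import Summits.HodgeConjecture.HodgeConjecture.Theorems.F0P2nFrobeniusFunctional
import HarnessLib

/-!
# Crux `H413`, programme P2 — row U1-DISJOINT, step (4) of the «up the tower» road: TWO IRREDUCIBLE SMOOTH REPRESENTATIONS CARRYING NON-ZERO
# `(P, χ·δ_P^{1/2})`-EIGENFUNCTIONALS FOR THE SAME REGULAR `χ` (`χ ≠ wχ`) INSIDE `I` WITH `r_P(I) = (wχ-line) ⊕ (χ-part)` ARE ISOMORPHIC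

Cell `hodgecm-mathlib` (D-0151), FLOOR 0, crux item H413 = stmt-HodgeConjecture-24833; K1 sub-line of the U′-N pay-down
`Cruxes/H413/Lines/F0_P2GR91NJacquetK1.lean`; booked row «U1-DISJOINT» (desk F0P2-plan (g7) 2026-08-31T15:40:57Z) = the in-house residual behind
the ★ `(U(1),U(1))` dichotomy letter `GelbartRogawski1991.u1ThetaDichotomy_nonsplit`; road «up the tower» (F0P2-p01 (g7)): a character `ψ` of `E¹_v`
occurring in the rank-one Weil representations of TWO line classes gives (★ letter N3ᵟ + ★ K1b) two irreducible theta types `X^{ε₁}, X^{ε₂}` of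
`U(Φ₃)(L⁺_v)` with non-zero Borel eigenfunctionals for the SAME character `χθʷ`; by THIS FILE they are isomorphic; ★ rank-3 disjointness
`MoeglinVignerasWaldspurger1987.rankOne_theta_lines_disjoint_holds` then forces the two lines into one class.

THIS FILE is the GENERIC kernel statement (any topological group `G`, parabolic triple `t = (P, M, N)` with `N` a union of compact open subgroups
— left exactness ★ `Representation.jacquetMap_injective` — and `δ_P^{1/2}|_N = 1`; any smooth `I` whose normalised Jacquet module is 2-dimensional
with a line on which `M` acts by `wχ`, `χ m₀ ≠ wχ m₀`).  THEOREMS ONLY, no letter, no `sorry` (kernel lane `--supports stmt-HodgeConjecture-24833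
--as helper`).  The CM INSTANTIATION (`G = U(Φ₃)(L⁺_v)`, `t = cmBorelTriple L 3 v` with ★ `isLimitOfCompactOpen_cmBorelTriple_N` and ★
`rootDeltaChar_cmBorel_eq_one`, `I = cmPrincipalSeries`, Jacquet data from the ★ letter N1 `UnitaryGroup.U3PrincipalSeriesJacquetFiltration`)
elaborates (checked, rc 0) but costs ≈ 12 min of unification against N1's stored statement (a fresh elaboration of N1's own conjunct text does
not match its stored instance terms syntactically; each `have : ‹N1 conjunct› := hfin` exceeds 1.2 M heartbeats), so it is left to the U1-DISJOINT
assembler, who unpacks N1 once; see the F0∕P2 bus 2026-08-31 (F0P2-p01 (g7)).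

THE ARGUMENT (`χ ≠ wχ` at one `m₀ ∈ M`).  Let `Φᵢ : πᵢ ↪ I` be injective intertwining maps from irreducible `πᵢ` (for `I = i_P^G(χ)` they come
from the eigenfunctionals by Frobenius, ★ `F0P2nFrobeniusFunctional`), `N₂ = im Φ₂`, `Q = I ⧸ N₂`.  If `im Φ₁ ⊄ N₂` then `π₁ ↪ Q` (irreducibility),
so `r(π₁) ↪ r(Q)` (left exactness, `Q` smooth).  `r(I) = ℓ_{wχ} ⊕ (χ-part)` is 2-dimensional; `r(π₂) ↪ r(I)` is NOT inside the `wχ`-line (else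
`M` acts on `r(π₂)` by `wχ`, killing the `χ`-eigenfunctional `ℓ̄₂` induced by `ℓ₂ ≠ 0`), hence `r(N₂) + ℓ_{wχ} = r(I)` and `M` acts on
`r(Q) = r(I) ⧸ (⊇ r(N₂))` by the scalar `wχ`; then `M` acts on `r(π₁) ↪ r(Q)` by `wχ`, killing `ℓ̄₁` — contradiction with `ℓ₁ ≠ 0`.  So
`im Φ₁ ⊆ im Φ₂`, symmetrically `im Φ₂ ⊆ im Φ₁`, and `π₁ ≅ im Φ₁ = im Φ₂ ≅ π₂`.

* §1 bookkeeping: `jacquetMap_normalizedJacquet`, `exists_coinvFunctional` (a `(P, χ·δ^{1/2})`-eigenfunctional descends to a `χ`-eigenfunctional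
  of the normalised Jacquet module), `coinvFunctional_eq_zero_of_scalar`, `scalar_of_injective`.
* §2 `range_le_of_eigenfunctionals` (one inclusion), `nonempty_equiv_of_range_eq`, **`equiv_of_eigenfunctionals`** (abstract `I`, `Φᵢ` given) and
  **`equiv_of_eigenfunctionals_normalizedInd`** (`I = i_P^G(χ)`, the `Φᵢ` produced from the eigenfunctionals by Frobenius).

HONEST LABEL: HC_CM is proved only modulo the printed citations until rung 0 closes; nothing here is a letter or conditional.

## References
* [BernsteinZelevinsky1977] I. N. Bernstein, A. V. Zelevinsky, Ann. Sci. ÉNS 10 (1977): §1.8–1.9 (Jacquet functor, exactness), §2.3 (normalised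
  functors), Thm. 2.9.
* [Casselman1995] W. Casselman, *Introduction to the theory of admissible representations of p-adic reductive groups* (draft 1995): Prop. 3.2.3
  (exactness), Thm. 3.2.4 (Frobenius reciprocity), §6.3 (Jacquet modules of principal series).
* [Rogawski1990] J. Rogawski, Ann. of Math. Stud. 123 (1990): §12.1 p. 172, §12.2 pp. 173–174 (`i_G(χ)`, `wχ = (χ̄₁⁻¹, χ₂)`).
-/

set_option autoImplicit false
-- the mandated namespace has the single-problem summit's repeated segment (`HodgeConjecture.HodgeConjecture`)
set_option linter.dupNamespace false

noncomputable section

open NumberField IsDedekindDomain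
open scoped Matrix

open Literature.NumberTheory Literature.NumberTheory.Automorphic Literature.NumberTheory.Automorphic.UnitaryGroup
open Literature.NumberTheory.GaloisRepresentations

namespace Summit.HodgeConjecture.HodgeConjecture.Cruxes.H413.F0P2pPrincipalSeriesUniqueSub

/-! ## §1 Bookkeeping on normalised Jacquet modules -/

section Generic

variable {G : Type*} [Group G] [TopologicalSpace G] [IsTopologicalGroup G] (t : ParabolicTriple G) [LocallyCompactSpace t.P]
  {V W : Type*} [AddCommGroup V] [Module ℂ V] [AddCommGroup W] [Module ℂ W]

/-- **Jacquet functoriality commutes with the NORMALISED action**: `r(f) (δ^{-1/2}(m)·[ρ m v]) = δ^{-1/2}(m)·[ρ' m (f v)]`.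
[cite: BernsteinZelevinsky1977, §2.3] -/
theorem jacquetMap_normalizedJacquet {ρ : Representation ℂ G V} {ρ' : Representation ℂ G W} (f : ρ.IntertwiningMap ρ')
    (m : t.M) (x : (t.restrict ρ).Coinvariants) :
    Representation.jacquetMap t f (ρ.normalizedJacquet t m x) = ρ'.normalizedJacquet t m (Representation.jacquetMap t f x) := by
  obtain ⟨v, rfl⟩ := Representation.Coinvariants.mk_surjective _ x
  rw [Representation.normalizedJacquet_mk, map_smul, Representation.jacquetMap_mk, Representation.jacquetMap_mk,
    Representation.normalizedJacquet_mk, f.isIntertwining]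

/-- **A `(P, χ·δ_P^{1/2})`-eigenfunctional descends to a `χ`-eigenfunctional of the normalised Jacquet module**: if
`ℓ (ρ p v) = χ(proj p) · δ^{1/2}(p) · ℓ v` for all `p ∈ P` and `δ^{1/2}|_N = 1`, then `ℓ` kills `ρ n v − v` (`n ∈ N`), so it factors through the
`N`-coinvariants as `ℓ̄` with `ℓ̄ ∘ [·] = ℓ` and `ℓ̄ (δ^{-1/2}(m)·[ρ m v]) = χ(m) · ℓ̄ [v]`. [cite: BernsteinZelevinsky1977, §1.8, §2.3]
[cite: Casselman1995, Thm. 3.2.4] -/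
theorem exists_coinvFunctional (hδ : ∀ (n : G) (hn : n ∈ t.N), rootDeltaChar t.P ⟨n, t.N_le hn⟩ = 1) (χ : t.M →* ℂˣ)
    (ρ : Representation ℂ G V) (ℓ : V →ₗ[ℂ] ℂ)
    (hℓ : ∀ (p : t.P) (v : V), ℓ (ρ p v) = ((χ (t.proj p) : ℂˣ) : ℂ) * ((rootDeltaChar t.P p : ℂˣ) : ℂ) * ℓ v) :
    ∃ ℓbar : (t.restrict ρ).Coinvariants →ₗ[ℂ] ℂ,
      (∀ v, ℓbar (Representation.Coinvariants.mk (t.restrict ρ) v) = ℓ v) ∧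
      ∀ (m : t.M) (x : (t.restrict ρ).Coinvariants), ℓbar (ρ.normalizedJacquet t m x) = ((χ m : ℂˣ) : ℂ) * ℓbar x := by
  -- `ℓ` is `N`-invariant
  have hN : ∀ n : ↥(t.N.subgroupOf t.P), ℓ ∘ₗ (t.restrict ρ) n = ℓ := by
    intro n
    ext v
    have hn : ((n : t.P) : G) ∈ t.N := n.2
    have hproj : t.proj (n : t.P) = 1 := t.proj_apply_of_mem_N _ hn
    have hδn : rootDeltaChar t.P (n : t.P) = 1 := by
      have := hδ _ hn
      convert this
    rw [LinearMap.comp_apply]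
    change ℓ (ρ ((n : t.P) : G) v) = ℓ v
    rw [hℓ, hproj, map_one, hδn, Units.val_one, one_mul, one_mul]
  refine ⟨Representation.Coinvariants.lift (t.restrict ρ) ℓ hN, fun v => ?_, fun m x => ?_⟩
  · rw [Representation.Coinvariants.lift_mk]
  · obtain ⟨v, rfl⟩ := Representation.Coinvariants.mk_surjective _ x
    rw [Representation.normalizedJacquet_mk, map_smul, Representation.Coinvariants.lift_mk, Representation.Coinvariants.lift_mk,
      smul_eq_mul]
    have hm := hℓ (Subgroup.inclusion t.M_le m) v
    have hproj : t.proj (Subgroup.inclusion t.M_le m) = m := Subtype.ext (t.proj_apply_of_mem_M _ m.2)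
    rw [hproj] at hm
    change ((((rootDeltaChar t.P (Subgroup.inclusion t.M_le m))⁻¹ : ℂˣ) : ℂ)) * ℓ (ρ ((Subgroup.inclusion t.M_le m : t.P) : G) v) = _
    rw [hm, ← mul_assoc, ← mul_assoc, mul_right_comm _ ((χ m : ℂˣ) : ℂ), ← Units.val_mul, inv_mul_cancel, Units.val_one, one_mul]

omit [TopologicalSpace G] [IsTopologicalGroup G] [LocallyCompactSpace t.P] in
/-- **A `χ`-eigenfunctional on a module where the torus acts by the scalar `χ′` dies as soon as `χ m₀ ≠ χ′ m₀`.** [folklore]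
[cite: BernsteinZelevinsky1977, §2.3] -/
theorem coinvFunctional_eq_zero_of_scalar {C : Type*} [AddCommGroup C] [Module ℂ C] (σ : Representation ℂ t.M C)
    (χ χ' : t.M →* ℂˣ) (m₀ : t.M) (hm₀ : χ m₀ ≠ χ' m₀)
    (hσ : ∀ (m : t.M) (x : C), σ m x = ((χ' m : ℂˣ) : ℂ) • x)
    (ℓbar : C →ₗ[ℂ] ℂ) (hℓ : ∀ (m : t.M) (x : C), ℓbar (σ m x) = ((χ m : ℂˣ) : ℂ) * ℓbar x) : ℓbar = 0 := by
  ext x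
  have h := hℓ m₀ x
  rw [hσ m₀ x, map_smul, smul_eq_mul] at h
  -- `(χ' m₀ - χ m₀) · ℓbar x = 0` with `χ' m₀ ≠ χ m₀`
  have hne : ((χ' m₀ : ℂˣ) : ℂ) - ((χ m₀ : ℂˣ) : ℂ) ≠ 0 :=
    sub_ne_zero.2 fun h' => hm₀ (Units.val_injective h'.symm)
  have : (((χ' m₀ : ℂˣ) : ℂ) - ((χ m₀ : ℂˣ) : ℂ)) * ℓbar x = 0 := by rw [sub_mul, h, sub_self]
  rw [LinearMap.zero_apply]
  exact (mul_eq_zero.1 this).resolve_left hne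

omit [TopologicalSpace G] [IsTopologicalGroup G] [LocallyCompactSpace t.P] in
/-- **Transport of a scalar action along an injective equivariant map**: if `j : C₁ ↪ C₂` intertwines `σ₁, σ₂` and `σ₂` acts by the scalar
`χ′`, so does `σ₁`. [folklore] [cite: BernsteinZelevinsky1977, §1.9] -/
theorem scalar_of_injective {C₁ C₂ : Type*} [AddCommGroup C₁] [Module ℂ C₁] [AddCommGroup C₂] [Module ℂ C₂]
    (σ₁ : Representation ℂ t.M C₁) (σ₂ : Representation ℂ t.M C₂) (j : C₁ →ₗ[ℂ] C₂) (hj : Function.Injective j)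
    (hj' : ∀ (m : t.M) (x : C₁), j (σ₁ m x) = σ₂ m (j x)) (χ' : t.M →* ℂˣ)
    (hσ₂ : ∀ (m : t.M) (y : C₂), σ₂ m y = ((χ' m : ℂˣ) : ℂ) • y) (m : t.M) (x : C₁) :
    σ₁ m x = ((χ' m : ℂˣ) : ℂ) • x :=
  hj (by rw [hj', hσ₂, map_smul])

end Generic

/-! ## §2 GENERIC: two irreducible subs of a smooth `I` with `r_P(I) = (wχ-line) ⊕ (χ-part)` carrying `χ`-eigenfunctionals coincide -/

section GenericMain

variable {G : Type*} [Group G] [TopologicalSpace G] [IsTopologicalGroup G] (t : ParabolicTriple G) [LocallyCompactSpace t.P]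

set_option maxHeartbeats 1600000 in
/-- **ONE INCLUSION (generic).**  `G` a topological group, `t = (P, M, N)` a parabolic triple with `N` a union of compact open subgroups
(`hN`, so the Jacquet functor is left exact, ★ `Representation.jacquetMap_injective`) and `δ_P^{1/2}|_N = 1` (`hδ`); `I` a smooth
representation whose Jacquet module `r(I)` is 2-dimensional with a line `lin` on which `M` acts (normalised) by `wχ`; `χ m₀ ≠ wχ m₀`.  If
`π₁, π₂` are irreducible smooth with NON-ZERO `(P, χ·δ_P^{1/2})`-eigenfunctionals `ℓ₁, ℓ₂` and non-zero intertwining maps `Φᵢ : πᵢ → I`, then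
`im Φ₁ ≤ im Φ₂`.  Proof in the module docstring (otherwise `π₁ ↪ I ⧸ im Φ₂`, whose Jacquet module is `wχ`-scalar — killing `ℓ̄₁`).
[cite: BernsteinZelevinsky1977, §1.9, §2.3, Thm. 2.9] [cite: Casselman1995, Prop. 3.2.3, Thm. 3.2.4] -/
theorem range_le_of_eigenfunctionals (hN : IsLimitOfCompactOpen t.N)
    (hδ : ∀ (n : G) (hn : n ∈ t.N), rootDeltaChar t.P ⟨n, t.N_le hn⟩ = 1)
    {W : Type*} [AddCommGroup W] [Module ℂ W] (I : Representation ℂ G W) (hIsm : I.IsSmooth)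
    (χ wχ : t.M →* ℂˣ) (m₀ : t.M) (hm₀ : χ m₀ ≠ wχ m₀)
    (hfin : FiniteDimensional ℂ (t.restrict I).Coinvariants) (hdim : Module.finrank ℂ (t.restrict I).Coinvariants = 2)
    (lin : Submodule ℂ (t.restrict I).Coinvariants) (hlin1 : Module.finrank ℂ ↥lin = 1)
    (hlinw : ∀ (m : t.M), ∀ x ∈ lin, I.normalizedJacquet t m x = ((wχ m : ℂˣ) : ℂ) • x)
    {V₁ V₂ : Type*} [AddCommGroup V₁] [Module ℂ V₁] [AddCommGroup V₂] [Module ℂ V₂]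
    (π₁ : Representation ℂ G V₁) (π₂ : Representation ℂ G V₂)
    (h₁ : π₁.IsIrreducible) (h₂ : π₂.IsIrreducible)
    (ℓ₁ : V₁ →ₗ[ℂ] ℂ) (hℓ₁0 : ℓ₁ ≠ 0)
    (hℓ₁ : ∀ (p : t.P) (w : V₁), ℓ₁ (π₁ p w) = ((χ (t.proj p) : ℂˣ) : ℂ) * ((rootDeltaChar t.P p : ℂˣ) : ℂ) * ℓ₁ w)
    (ℓ₂ : V₂ →ₗ[ℂ] ℂ) (hℓ₂0 : ℓ₂ ≠ 0)
    (hℓ₂ : ∀ (p : t.P) (w : V₂), ℓ₂ (π₂ p w) = ((χ (t.proj p) : ℂˣ) : ℂ) * ((rootDeltaChar t.P p : ℂˣ) : ℂ) * ℓ₂ w)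
    (Φ₁ : π₁.IntertwiningMap I) (Φ₂ : π₂.IntertwiningMap I) (hΦ₂ : Φ₂ ≠ 0) :
    Φ₁.range ≤ Φ₂.range := by
  haveI : π₁.IsIrreducible := h₁
  haveI : π₂.IsIrreducible := h₂
  haveI := hfin
  have hinj₂ : Function.Injective Φ₂ := (Representation.IsIrreducible.injective_or_eq_zero Φ₂).resolve_right hΦ₂
  -- the descended eigenfunctionals
  obtain ⟨ℓb₁, hℓb₁, hℓb₁χ⟩ := exists_coinvFunctional t hδ χ π₁ ℓ₁ hℓ₁
  obtain ⟨ℓb₂, hℓb₂, hℓb₂χ⟩ := exists_coinvFunctional t hδ χ π₂ ℓ₂ hℓ₂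
  have hℓb₁0 : ℓb₁ ≠ 0 := by
    intro h0; apply hℓ₁0; ext w; rw [← hℓb₁ w, h0, LinearMap.zero_apply, LinearMap.zero_apply]
  have hℓb₂0 : ℓb₂ ≠ 0 := by
    intro h0; apply hℓ₂0; ext w; rw [← hℓb₂ w, h0, LinearMap.zero_apply, LinearMap.zero_apply]
  -- the quotient `Q = I ⧸ im Φ₂`
  have hQsm : (Φ₂.range).quotientRep.IsSmooth := hIsm.quotientRep Φ₂.range
  rcases (IsSimpleOrder.eq_bot_or_eq_top ((Φ₂.range.mkQ).comp Φ₁).ker) with hk | hk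
  · -- `π₁ ↪ Q`: contradiction from the Jacquet modules
    exfalso
    have hinj' : Function.Injective ((Φ₂.range.mkQ).comp Φ₁) := by
      intro a b hab
      have hmem : a - b ∈ ((Φ₂.range.mkQ).comp Φ₁).ker := by
        rw [Representation.IntertwiningMap.mem_ker, map_sub, hab, sub_self]
      rw [hk] at hmem
      exact sub_eq_zero.1 hmem
    -- (a) `r(Φ₂)` is injective; its image is not inside the `wχ`-line
    have hj₂ : Function.Injective (Representation.jacquetMap t Φ₂) := Representation.jacquetMap_injective t hN hIsm Φ₂ hinj₂
    have hnot : ∃ z : (t.restrict π₂).Coinvariants, Representation.jacquetMap t Φ₂ z ∉ lin := by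
      by_contra hall
      push Not at hall
      have hsc : ∀ (m : t.M) (x : (t.restrict π₂).Coinvariants), π₂.normalizedJacquet t m x = ((wχ m : ℂˣ) : ℂ) • x := by
        intro m x
        apply hj₂
        rw [jacquetMap_normalizedJacquet, map_smul]
        exact hlinw m _ (hall x)
      exact hℓb₂0 (coinvFunctional_eq_zero_of_scalar t (π₂.normalizedJacquet t) χ wχ m₀ hm₀ hsc ℓb₂ hℓb₂χ)
    obtain ⟨z, hz⟩ := hnot
    -- (b) `lin + im r(Φ₂) = ⊤` (a line plus a vector outside it, in a plane)
    have htop : lin ⊔ LinearMap.range (Representation.jacquetMap t Φ₂).toLinearMap = ⊤ := by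
      have hlt : lin < lin ⊔ LinearMap.range (Representation.jacquetMap t Φ₂).toLinearMap := by
        refine lt_of_le_of_ne le_sup_left fun heq => hz ?_
        have hmem : Representation.jacquetMap t Φ₂ z ∈ lin ⊔ LinearMap.range (Representation.jacquetMap t Φ₂).toLinearMap :=
          Submodule.mem_sup_right ⟨z, rfl⟩
        rwa [← heq] at hmem
      have h2 : 2 ≤ Module.finrank ℂ ↥(lin ⊔ LinearMap.range (Representation.jacquetMap t Φ₂).toLinearMap) := by
        have := Submodule.finrank_lt_finrank_of_lt hlt
        omega
      apply Submodule.eq_top_of_finrank_eq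
      refine le_antisymm (Submodule.finrank_le _) ?_
      rw [hdim]; exact h2
    -- (c) `M` acts on `r(Q)` by `wχ`
    have hrq0 : ∀ y ∈ LinearMap.range (Representation.jacquetMap t Φ₂).toLinearMap,
        Representation.jacquetMap t (Φ₂.range.mkQ) y = 0 := by
      rintro _ ⟨x, rfl⟩
      obtain ⟨w, rfl⟩ := Representation.Coinvariants.mk_surjective _ x
      change Representation.jacquetMap t (Φ₂.range.mkQ) (Representation.jacquetMap t Φ₂ (Representation.Coinvariants.mk _ w)) = 0
      rw [Representation.jacquetMap_mk, Representation.jacquetMap_mk, Subrepresentation.mkQ_apply,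
        (Submodule.Quotient.mk_eq_zero _).2 ((Representation.IntertwiningMap.mem_range _ _ _ _).2 ⟨w, rfl⟩), map_zero]
    have hQsc : ∀ (m : t.M) (y : (t.restrict (Φ₂.range).quotientRep).Coinvariants),
        (Φ₂.range).quotientRep.normalizedJacquet t m y = ((wχ m : ℂˣ) : ℂ) • y := by
      intro m y
      obtain ⟨x, rfl⟩ := Representation.jacquetMap_surjective t (Φ₂.range.mkQ) (Φ₂.range).mkQ_surjective y
      have hx : x ∈ lin ⊔ LinearMap.range (Representation.jacquetMap t Φ₂).toLinearMap := by rw [htop]; exact Submodule.mem_top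
      obtain ⟨a, ha, b, hb, rfl⟩ := Submodule.mem_sup.1 hx
      rw [map_add, hrq0 b hb, add_zero, ← jacquetMap_normalizedJacquet, hlinw m a ha, map_smul]
    -- (d) `r(π₁) ↪ r(Q)` is then `wχ`-scalar, killing `ℓ̄₁`
    have hj₁ : Function.Injective (Representation.jacquetMap t ((Φ₂.range.mkQ).comp Φ₁)) :=
      Representation.jacquetMap_injective t hN hQsm _ hinj'
    have hsc₁ : ∀ (m : t.M) (x : (t.restrict π₁).Coinvariants), π₁.normalizedJacquet t m x = ((wχ m : ℂˣ) : ℂ) • x :=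
      scalar_of_injective t (π₁.normalizedJacquet t) ((Φ₂.range).quotientRep.normalizedJacquet t)
        (Representation.jacquetMap t ((Φ₂.range.mkQ).comp Φ₁)).toLinearMap hj₁
        (fun m x => jacquetMap_normalizedJacquet t _ m x) wχ hQsc
    exact hℓb₁0 (coinvFunctional_eq_zero_of_scalar t (π₁.normalizedJacquet t) χ wχ m₀ hm₀ hsc₁ ℓb₁ hℓb₁χ)
  · -- `Φ₁` lands in `im Φ₂`
    intro x hx
    obtain ⟨a, rfl⟩ := (Representation.IntertwiningMap.mem_range _ _ _ _).1 hx
    have ha : a ∈ ((Φ₂.range.mkQ).comp Φ₁).ker := by rw [hk]; trivial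
    rw [Representation.IntertwiningMap.mem_ker, Representation.IntertwiningMap.comp_apply, Subrepresentation.mkQ_eq_zero_iff] at ha
    exact ha

omit [TopologicalSpace G] [IsTopologicalGroup G] in
/-- **Equal images ⇒ isomorphic sources** for injective intertwining maps. [folklore] [cite: BernsteinZelevinsky1977, §1.9] -/
theorem nonempty_equiv_of_range_eq {W : Type*} [AddCommGroup W] [Module ℂ W] (I : Representation ℂ G W)
    {V₁ V₂ : Type*} [AddCommGroup V₁] [Module ℂ V₁] [AddCommGroup V₂] [Module ℂ V₂]
    (π₁ : Representation ℂ G V₁) (π₂ : Representation ℂ G V₂)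
    (Φ₁ : π₁.IntertwiningMap I) (Φ₂ : π₂.IntertwiningMap I) (hinj₁ : Function.Injective Φ₁) (hinj₂ : Function.Injective Φ₂)
    (hR : LinearMap.range Φ₁.toLinearMap = LinearMap.range Φ₂.toLinearMap) : Nonempty (π₁.Equiv π₂) := by
  let e₁ : V₁ ≃ₗ[ℂ] ↥(LinearMap.range Φ₁.toLinearMap) := LinearEquiv.ofInjective Φ₁.toLinearMap hinj₁
  let e₂ : V₂ ≃ₗ[ℂ] ↥(LinearMap.range Φ₂.toLinearMap) := LinearEquiv.ofInjective Φ₂.toLinearMap hinj₂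
  let e : V₁ ≃ₗ[ℂ] V₂ := (e₁.trans (LinearEquiv.ofEq _ _ hR)).trans e₂.symm
  have he : ∀ x : V₁, Φ₂ (e x) = Φ₁ x := by
    intro x
    have h2 : ∀ y : ↥(LinearMap.range Φ₂.toLinearMap), Φ₂.toLinearMap (e₂.symm y) = y := fun y => by
      have := LinearEquiv.ofInjective_apply (f := Φ₂.toLinearMap) (h := hinj₂) (e₂.symm y)
      rw [LinearEquiv.apply_symm_apply] at this
      exact this.symm
    change Φ₂.toLinearMap (e₂.symm ((LinearEquiv.ofEq _ _ hR) (e₁ x))) = Φ₁ x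
    rw [h2, LinearEquiv.coe_ofEq_apply, LinearEquiv.ofInjective_apply]
    rfl
  refine ⟨Representation.Equiv.mk e fun g => ?_⟩
  ext x
  rw [LinearMap.comp_apply, LinearMap.comp_apply]
  change e (π₁ g x) = π₂ g (e x)
  apply hinj₂
  rw [he, Φ₁.isIntertwining, Φ₂.isIntertwining, he]

set_option maxHeartbeats 1600000 in
/-- **ISOMORPHISM (generic).**  In the setting of `range_le_of_eigenfunctionals`, `π₁ ≅ π₂` (`Representation.Equiv`): both inclusions hold,
so `im Φ₁ = im Φ₂` and `π₁ ≅ im Φ₁ = im Φ₂ ≅ π₂`. [cite: BernsteinZelevinsky1977, Thm. 2.9, §2.3] [cite: Casselman1995, Thm. 3.2.4] -/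
theorem equiv_of_eigenfunctionals (hN : IsLimitOfCompactOpen t.N)
    (hδ : ∀ (n : G) (hn : n ∈ t.N), rootDeltaChar t.P ⟨n, t.N_le hn⟩ = 1)
    {W : Type*} [AddCommGroup W] [Module ℂ W] (I : Representation ℂ G W) (hIsm : I.IsSmooth)
    (χ wχ : t.M →* ℂˣ) (m₀ : t.M) (hm₀ : χ m₀ ≠ wχ m₀)
    (hfin : FiniteDimensional ℂ (t.restrict I).Coinvariants) (hdim : Module.finrank ℂ (t.restrict I).Coinvariants = 2)
    (lin : Submodule ℂ (t.restrict I).Coinvariants) (hlin1 : Module.finrank ℂ ↥lin = 1)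
    (hlinw : ∀ (m : t.M), ∀ x ∈ lin, I.normalizedJacquet t m x = ((wχ m : ℂˣ) : ℂ) • x)
    {V₁ V₂ : Type*} [AddCommGroup V₁] [Module ℂ V₁] [AddCommGroup V₂] [Module ℂ V₂]
    (π₁ : Representation ℂ G V₁) (π₂ : Representation ℂ G V₂)
    (h₁ : π₁.IsIrreducible) (h₂ : π₂.IsIrreducible)
    (ℓ₁ : V₁ →ₗ[ℂ] ℂ) (hℓ₁0 : ℓ₁ ≠ 0)
    (hℓ₁ : ∀ (p : t.P) (w : V₁), ℓ₁ (π₁ p w) = ((χ (t.proj p) : ℂˣ) : ℂ) * ((rootDeltaChar t.P p : ℂˣ) : ℂ) * ℓ₁ w)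
    (ℓ₂ : V₂ →ₗ[ℂ] ℂ) (hℓ₂0 : ℓ₂ ≠ 0)
    (hℓ₂ : ∀ (p : t.P) (w : V₂), ℓ₂ (π₂ p w) = ((χ (t.proj p) : ℂˣ) : ℂ) * ((rootDeltaChar t.P p : ℂˣ) : ℂ) * ℓ₂ w)
    (Φ₁ : π₁.IntertwiningMap I) (Φ₂ : π₂.IntertwiningMap I) (hΦ₁ : Φ₁ ≠ 0) (hΦ₂ : Φ₂ ≠ 0) :
    Nonempty (π₁.Equiv π₂) := by
  haveI : π₁.IsIrreducible := h₁
  haveI : π₂.IsIrreducible := h₂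
  have hinj₁ : Function.Injective Φ₁ := (Representation.IsIrreducible.injective_or_eq_zero Φ₁).resolve_right hΦ₁
  have hinj₂ : Function.Injective Φ₂ := (Representation.IsIrreducible.injective_or_eq_zero Φ₂).resolve_right hΦ₂
  have h12 := range_le_of_eigenfunctionals t hN hδ I hIsm χ wχ m₀ hm₀ hfin hdim lin hlin1 hlinw π₁ π₂ h₁ h₂ ℓ₁ hℓ₁0 hℓ₁ ℓ₂ hℓ₂0 hℓ₂
    Φ₁ Φ₂ hΦ₂
  have h21 := range_le_of_eigenfunctionals t hN hδ I hIsm χ wχ m₀ hm₀ hfin hdim lin hlin1 hlinw π₂ π₁ h₂ h₁ ℓ₂ hℓ₂0 hℓ₂ ℓ₁ hℓ₁0 hℓ₁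
    Φ₂ Φ₁ hΦ₁
  refine nonempty_equiv_of_range_eq I π₁ π₂ Φ₁ Φ₂ hinj₁ hinj₂ (le_antisymm ?_ ?_)
  · rintro _ ⟨a, rfl⟩; exact h12 ((Representation.IntertwiningMap.mem_range _ _ _ _).2 ⟨a, rfl⟩)
  · rintro _ ⟨a, rfl⟩; exact h21 ((Representation.IntertwiningMap.mem_range _ _ _ _).2 ⟨a, rfl⟩)

set_option maxHeartbeats 1600000 in
/-- **ISOMORPHISM for `I = i_P^G(χ)` (★ `Representation.normalizedInd`), the `Φᵢ` PRODUCED from the eigenfunctionals by Frobenius-by-functional**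
(★ `F0P2nFrobeniusFunctional.exists_intertwiningMap_normalizedInd_character_of_functional`; `I` is smooth by ★ `Representation.isSmooth_smoothInd`).
The form the U1-DISJOINT assembler consumes at `t = cmBorelTriple L 3 v`, `χ = χθʷ`, Jacquet data from the letter N1.
[cite: BernsteinZelevinsky1977, Thm. 2.9, §2.3] [cite: Casselman1995, Thm. 3.2.4] -/
theorem equiv_of_eigenfunctionals_normalizedInd (hN : IsLimitOfCompactOpen t.N)
    (hδ : ∀ (n : G) (hn : n ∈ t.N), rootDeltaChar t.P ⟨n, t.N_le hn⟩ = 1)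
    (χ wχ : t.M →* ℂˣ) (m₀ : t.M) (hm₀ : χ m₀ ≠ wχ m₀)
    (hfin : FiniteDimensional ℂ (t.restrict (Representation.normalizedInd t ((Representation.trivial ℂ t.M ℂ).twist χ))).Coinvariants)
    (hdim : Module.finrank ℂ (t.restrict (Representation.normalizedInd t ((Representation.trivial ℂ t.M ℂ).twist χ))).Coinvariants = 2)
    (lin : Submodule ℂ (t.restrict (Representation.normalizedInd t ((Representation.trivial ℂ t.M ℂ).twist χ))).Coinvariants)
    (hlin1 : Module.finrank ℂ ↥lin = 1)
    (hlinw : ∀ (m : t.M), ∀ x ∈ lin,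
      (Representation.normalizedInd t ((Representation.trivial ℂ t.M ℂ).twist χ)).normalizedJacquet t m x = ((wχ m : ℂˣ) : ℂ) • x)
    {V₁ V₂ : Type*} [AddCommGroup V₁] [Module ℂ V₁] [AddCommGroup V₂] [Module ℂ V₂]
    (π₁ : Representation ℂ G V₁) (π₂ : Representation ℂ G V₂)
    (h₁ : π₁.IsIrreducible) (hs₁ : π₁.IsSmooth) (h₂ : π₂.IsIrreducible) (hs₂ : π₂.IsSmooth)
    (ℓ₁ : V₁ →ₗ[ℂ] ℂ) (hℓ₁0 : ℓ₁ ≠ 0)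
    (hℓ₁ : ∀ (p : t.P) (w : V₁), ℓ₁ (π₁ p w) = ((χ (t.proj p) : ℂˣ) : ℂ) * ((rootDeltaChar t.P p : ℂˣ) : ℂ) * ℓ₁ w)
    (ℓ₂ : V₂ →ₗ[ℂ] ℂ) (hℓ₂0 : ℓ₂ ≠ 0)
    (hℓ₂ : ∀ (p : t.P) (w : V₂), ℓ₂ (π₂ p w) = ((χ (t.proj p) : ℂˣ) : ℂ) * ((rootDeltaChar t.P p : ℂˣ) : ℂ) * ℓ₂ w) :
    Nonempty (π₁.Equiv π₂) := by
  obtain ⟨Φ₁, hΦ₁, -⟩ := F0P2nFrobeniusFunctional.exists_intertwiningMap_normalizedInd_character_of_functional t χ π₁ hs₁ ℓ₁ hℓ₁ hℓ₁0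
  obtain ⟨Φ₂, hΦ₂, -⟩ := F0P2nFrobeniusFunctional.exists_intertwiningMap_normalizedInd_character_of_functional t χ π₂ hs₂ ℓ₂ hℓ₂ hℓ₂0
  exact equiv_of_eigenfunctionals t hN hδ _ (Representation.isSmooth_smoothInd _ _) χ wχ m₀ hm₀ hfin hdim lin hlin1 hlinw
    π₁ π₂ h₁ h₂ ℓ₁ hℓ₁0 hℓ₁ ℓ₂ hℓ₂0 hℓ₂ Φ₁ Φ₂ hΦ₁ hΦ₂


end GenericMain


end Summit.HodgeConjecture.HodgeConjecture.Cruxes.H413.F0P2pPrincipalSeriesUniqueSub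

end
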